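import Summits.ResolutionOfSingularities.ResolutionOfSingularities.Theorems.StallVertexLockAlgebra
import HarnessLib

/-!
# StallVertexLock — decomp-res node «StallVertex» (lens-5 g23 rev 9), add-on tree file 2/4: THE TURN LOCK (§3j, walk level)

Content VERBATIM from the decomp-res lens-5 tree-ready slices
`HOME/decomp-res-lens-5/g23/parts/StallVertexLock.lean` (fe40ed9c) /
`StallVertexLockClasses.lean` (05ee4541) of the node file `g23/StallVertex.lean` rev 9 (pin fbb7fe50 = rev 8
9799ca34 + four pure insertions
§1l / §3j / §4k; critic machine diff, CRITIC-LEDGER row 162 DECIDED +1: THE TURN LOCK; HOME =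
run/shared/lean/pub/decomp-res; landing order
INBOX :609 / :618).  Landed by decomp-res writer g9 as `StallVertexLockAlgebra` (§1l), `StallVertexLock` (§3j),
`StallVertexLockClasses`
(§4k cells and exact re-locations, cone-free) and the wiring file `MaxContactCutStallVertexLock` (§4k chain to the
target BY NAME); the 420-line
slice is split only to respect the 400-line file cap, declarations and proofs byte-identical.

After an interference the untranslated walk turns AT MOST ONCE (`turn_lock_chain`, `turn_lock_law`,
`two_moves_after_interference`), hypothesis-free along root walks, every `q = p^e`, every field of characteristic `p`.
Generic §1l: the two monomials of a resonant two-layer cone (`coeff_two_layer_low/high`), three-letter degree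
bookkeeping (`Fin3.lt_third`).  Walk level §3j: `exponent_eq_of_originLawAt`, the invariant `TwoMarks` (born by
`twoMarks_of_interference_turn`, carried by `twoMarks_succ`, biting in `chart_eq_of_twoMarks`), the kernel predicates
`DoubleTurnAt` / `SecondTurnAt` and their exclusion on stalled stretches.  Host: route `MaxContactCut`, aside
`MaxContactCut.DefectWalksDeep` (stmt-…-31770); node file
`run/shared/lean/pub/decomp-res/decomp-res-lens-5/g23/StallVertex.lean`.
-/

noncomputable section

open MvPolynomial Finset
open Literature.AlgebraicGeometry.Resolution
open Literature.AlgebraicGeometry.Resolution.Hauser2010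
open Literature.AlgebraicGeometry.Resolution.HauserPerlega2024
open Literature.Barriers.ResolutionOfSingularities
open Literature.AlgebraicGeometry.Resolution.PointBlowup
open Summit.ResolutionOfSingularities.ResolutionOfSingularities.Theses
open Summit.ResolutionOfSingularities.ResolutionOfSingularities.Theorems.TightDefectClasses
open Summit.ResolutionOfSingularities.ResolutionOfSingularities.Theorems.ProximityCut
open Summit.ResolutionOfSingularities.ResolutionOfSingularities.Theorems.ExitLaw
open Summit.ResolutionOfSingularities.ResolutionOfSingularities.Theorems.DifferentialShade

namespace Summit.ResolutionOfSingularities.ResolutionOfSingularities.Theorems.StallVertex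

/-! ### §3j (rev 9, generation 23) THE TURN-LOCK LAW (walk level): after an interference the walk cannot make two
consecutive untranslated chart changes -/

section WalkLock

variable {K : Type} [Field K] [DecidableEq K]
variable {q : ℕ} {s₀ : State (Fin 3) K}

/-- **THE ORIGIN LAW PINS ONE EXPONENT**: at an untranslated move obeying the origin law, all monomials of the
initial form of a minimiser have the SAME exponent at the chart letter. [new] -/
theorem exponent_eq_of_originLawAt (W : ForcedWalk q s₀) (t : ℕ) (hO : OriginLawAt W t) (hb : ∀ i, W.b t i = 0)
    {J₀ : Fin 3 →₀ ℕ} (hJ₀ : J₀ ∈ (ifp W t).idx)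
    (hμ : (ifp W t).muP q = levelRatio (ordZero ((ifp W t).gen J₀)) (q - J₀.degree))
    {d₀ : ℕ} (hd₀ : ordZero ((ifp W t).gen J₀) = d₀) {s s' : Fin 3 →₀ ℕ}
    (hs : s ∈ (homogeneousComponent d₀ ((ifp W t).gen J₀)).support)
    (hs' : s' ∈ (homogeneousComponent d₀ ((ifp W t).gen J₀)).support) : s (W.j t) = s' (W.j t) := by
  have key : ∀ {x y : Fin 3 →₀ ℕ}, x ∈ (homogeneousComponent d₀ ((ifp W t).gen J₀)).support →
      y ∈ (homogeneousComponent d₀ ((ifp W t).gen J₀)).support → x (W.j t) ≤ y (W.j t) := by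
    intro x y hx hy
    have h1 := (hO hb J₀ hJ₀ hμ d₀ hd₀ x hx).1
    have h2 := (hO hb J₀ hJ₀ hμ d₀ hd₀ y hy).2
    by_cases hyoung : W.j t ∈ (ifp W t).young
    · rw [if_pos hyoung] at h1
      exact_mod_cast h1.trans h2
    · rw [if_neg hyoung, mul_zero] at h1
      have hx0 : x (W.j t) = 0 := by exact_mod_cast le_antisymm h1 (Nat.cast_nonneg _)
      rw [hx0]; exact Nat.zero_le _
  exact le_antisymm (key hs hs') (key hs' hs)

/-- **TWO MARKED MONOMIALS** (the invariant of the turn lock): at time `τ` some `μ_P`-minimiser `g₀` of known order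
`D` carries two monomials `u^{M₁}, u^{M₂}` in its initial form with THE SAME `u_{j'}`-exponent and `M₁(j) < M₂(j)` — hence
(same degree) opposite strict inequality at the third letter.  Born by `resonance` + the origin law at an untranslated turn
after an interference (`twoMarks_of_interference_turn`), carried verbatim through every untranslated chart-`j'` move
(`twoMarks_succ`), and forbidding every untranslated move in a chart `≠ j'` (`chart_eq_of_twoMarks`). -/
def TwoMarks (W : ForcedWalk q s₀) (τ : ℕ) (j j' : Fin 3) : Prop :=
  ∃ (J₀ : Fin 3 →₀ ℕ) (D : ℕ) (M₁ M₂ : Fin 3 →₀ ℕ), J₀ ∈ (ifp W τ).idx ∧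
    (ifp W τ).muP q = levelRatio (ordZero ((ifp W τ).gen J₀)) (q - J₀.degree) ∧
    ordZero ((ifp W τ).gen J₀) = D ∧
    M₁ ∈ (homogeneousComponent D ((ifp W τ).gen J₀)).support ∧
    M₂ ∈ (homogeneousComponent D ((ifp W τ).gen J₀)).support ∧ M₁ j' = M₂ j' ∧ M₁ j < M₂ j

/-- **THE MARKS PIN THE CHART**: on a stalled untranslated move, two marked monomials force the chart letter to be `j'`
(origin law: the chart letter's exponent is pinned; it differs between the marks at `j` and at the third letter). [new] -/
theorem chart_eq_of_twoMarks {p e : ℕ} (hp : p.Prime) [CharP K p] {s₀ : State (Fin 3) K} (hs : IsRoot (p ^ e) s₀)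
    (W : ForcedWalk (p ^ e) s₀) (τ : ℕ) {j j' : Fin 3} (hM : TwoMarks W τ j j') (hjj' : j' ≠ j)
    (hst : (ifp W (τ + 1)).muTilde (p ^ e) = (ifp W τ).muTilde (p ^ e)) (hb : ∀ i, W.b τ i = 0) :
    W.j τ = j' := by
  obtain ⟨J₀, D, M₁, M₂, hJ₀, hμ, hD, hM₁, hM₂, hj', hj⟩ := hM
  by_contra hc
  have hpin := exponent_eq_of_originLawAt W τ (originLawAt_of_stall hp hs W τ hst.symm.le) hb hJ₀ hμ hD hM₁ hM₂
  by_cases hcj : W.j τ = j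
  · rw [hcj] at hpin; omega
  · have hlt := Fin3.lt_third hjj' hcj hc ((degree_eq_of_mem_support_homogeneousComponent hM₁).trans
      (degree_eq_of_mem_support_homogeneousComponent hM₂).symm) hj' hj
    omega

/-- **BIRTH OF THE MARKS**: an interference at `t` (stalled) followed by a stalled untranslated move at `t + 1` leaves two
marked monomials at `t + 1` for the letters `(j_t, j_{t+1})`: `resonance` makes the cone the two-layer form
`u_j^E·(A + u_j·B)`, `A` `u_j`-free and `A, B ≠ 0` — one monomial from each layer (`coeff_two_layer_low/high`: nothing
cancels); the origin law at `t + 1` equalises their `u_{j_{t+1}}`-exponents. [new] -/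
theorem twoMarks_of_interference_turn {p e : ℕ} (hp : p.Prime) [CharP K p] {s₀ : State (Fin 3) K}
    (hs : IsRoot (p ^ e) s₀) (W : ForcedWalk (p ^ e) s₀) (t : ℕ)
    (hst : (ifp W (t + 1)).muTilde (p ^ e) = (ifp W t).muTilde (p ^ e))
    (hst' : (ifp W (t + 1 + 1)).muTilde (p ^ e) = (ifp W (t + 1)).muTilde (p ^ e))
    (hunc : ¬ CleanAt W t) (hb₁ : ∀ i, W.b (t + 1) i = 0) : TwoMarks W (t + 1) (W.j t) (W.j (t + 1)) := by
  classical
  -- the unclean minimiser at `t`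
  simp only [CleanAt, not_forall, exists_prop] at hunc
  obtain ⟨J₀, hJ₀, hμ, d₀, hd₀, hunc⟩ := hunc
  have hgne : (ifp W t).gen J₀ ≠ 0 := by
    intro h0; rw [h0, ordZero_zero] at hd₀; exact ENat.top_ne_coe _ hd₀
  have ha : p ^ e - J₀.degree ≤ d₀ := by
    have := sing_ifp hp hs W t J₀ hJ₀ hgne
    rw [hd₀] at this; exact_mod_cast this
  obtain ⟨n, hn⟩ := exists_ordZero_eq_natCast (dirForm_ne_zero (W.j t) (W.b t) hd₀)
  have hrig := stall_rigid (p ^ e) (W.j t) (W.b t) (W.onExc t) (ifp W t) (fun J hJ => (level_bounds W t J hJ).2)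
    (sing_ifp hp hs W t) (by rw [← ifp_succ]; exact hst.symm.le) hJ₀ hμ hd₀
  obtain ⟨-, h2, h3, -, -⟩ := hrig
  rw [hn, ENat.toNat_coe] at h2
  have hgen₁ : (ifp W (t + 1)).gen J₀ =
      PointBlowup.translate (W.b t) (chartTransform (p ^ e - J₀.degree) (W.j t) ((ifp W t).gen J₀)) := by
    rw [ifp_succ]; rfl
  have hd₁ : ordZero ((ifp W (t + 1)).gen J₀) = ((d₀ - (p ^ e - J₀.degree) + n : ℕ) : ℕ∞) := by
    rw [ifp_succ]; exact h2
  have hstallval : ordZero (PointBlowup.translate (W.b t)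
      (chartTransform (p ^ e - J₀.degree) (W.j t) ((ifp W t).gen J₀))) =
      ((d₀ - (p ^ e - J₀.degree) + n : ℕ) : ℕ∞) := by rw [← hgen₁]; exact hd₁
  -- resonance at `t`: the two-layer cone at `t + 1`
  obtain ⟨m, -, -, hB0, hcone⟩ := resonance (W.b t) (W.onExc t) ha hd₀ hn hstallval hunc
  rw [← hgen₁] at hcone
  have hJ₀' : J₀ ∈ (ifp W (t + 1)).idx := by rw [idx_ifp] at hJ₀ ⊢; exact hJ₀
  have hμ' : (ifp W (t + 1)).muP (p ^ e) =
      levelRatio (ordZero ((ifp W (t + 1)).gen J₀)) (p ^ e - J₀.degree) := by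
    rw [ifp_succ]; exact h3
  -- one monomial of each layer
  have hA0 : homogeneousComponent n (dirForm d₀ (W.j t) (W.b t) ((ifp W t).gen J₀)) ≠ 0 :=
    homogeneousComponent_ne_zero_of_ordZero_eq hn
  obtain ⟨sA, hsA⟩ := MvPolynomial.ne_zero_iff.mp hA0
  obtain ⟨sB, hsB⟩ := MvPolynomial.ne_zero_iff.mp hB0
  have hAfree : ∀ s ∈ (homogeneousComponent n (dirForm d₀ (W.j t) (W.b t) ((ifp W t).gen J₀))).support,
      s (W.j t) = 0 := fun s hs' =>
    dirForm_free d₀ (W.b t) (W.onExc t) _ s (mem_support_of_mem_support_homogeneousComponent hs')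
  have hsAj : sA (W.j t) = 0 := hAfree sA (MvPolynomial.mem_support_iff.mpr hsA)
  -- the two marks at `t + 1`
  refine ⟨J₀, d₀ - (p ^ e - J₀.degree) + n, sA + Finsupp.single (W.j t) (d₀ - (p ^ e - J₀.degree)),
    sB + Finsupp.single (W.j t) (d₀ - (p ^ e - J₀.degree) + 1), hJ₀', hμ', hd₁, ?_, ?_, ?_, ?_⟩
  · rw [MvPolynomial.mem_support_iff, hcone, coeff_two_layer_low _ _ _ _ hsAj]; exact hsA
  · rw [MvPolynomial.mem_support_iff, hcone, coeff_two_layer_high _ _ _ hAfree]; exact hsB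
  · -- origin law at `t + 1`: the common `u_{j'}`-exponent
    refine exponent_eq_of_originLawAt W (t + 1) (originLawAt_of_stall hp hs W (t + 1) hst'.symm.le) hb₁ hJ₀' hμ'
      hd₁ ?_ ?_
    · rw [MvPolynomial.mem_support_iff, hcone, coeff_two_layer_low _ _ _ _ hsAj]; exact hsA
    · rw [MvPolynomial.mem_support_iff, hcone, coeff_two_layer_high _ _ _ hAfree]; exact hsB
  · rw [Finsupp.add_apply, Finsupp.single_eq_same, hsAj, zero_add, Finsupp.add_apply, Finsupp.single_eq_same]
    omega

/-- **THE MARKS SURVIVE AN UNTRANSLATED CHART-`j'` MOVE** (stalled): the direction form of the move is the cone with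
`u_{j'}` deleted (homogeneous, since the origin law pins the `u_{j'}`-exponent), and the next cone contains
`u_{j'}^{E}·(direction form)` verbatim — by `initialForm_move_of_clean` when the move is clean, by `resonance` when it is
not (the tail layer has a larger `u_{j'}`-exponent and cancels nothing). [new] -/
theorem twoMarks_succ {p e : ℕ} (hp : p.Prime) [CharP K p] {s₀ : State (Fin 3) K} (hs : IsRoot (p ^ e) s₀)
    (W : ForcedWalk (p ^ e) s₀) (τ : ℕ) {j : Fin 3} (hM : TwoMarks W τ j (W.j τ))
    (hst : (ifp W (τ + 1)).muTilde (p ^ e) = (ifp W τ).muTilde (p ^ e)) (hb : ∀ i, W.b τ i = 0) :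
    TwoMarks W (τ + 1) j (W.j τ) := by
  classical
  obtain ⟨J₀, D₁, m₁, m₂, hJ₀', hμ', hd₁, hm₁mem, hm₂mem, hf, hm₁₂j⟩ := hM
  have hjj' : j ≠ W.j τ := by rintro rfl; omega
  have hO₁ := originLawAt_of_stall hp hs W τ hst.symm.le
  -- stall rigidity at `τ`: order and minimality at `τ + 1`
  have hgne₁ : (ifp W τ).gen J₀ ≠ 0 := by
    intro h0; rw [h0, ordZero_zero] at hd₁; exact ENat.top_ne_coe _ hd₁
  have ha₁ : p ^ e - J₀.degree ≤ D₁ := by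
    have := sing_ifp hp hs W τ J₀ hJ₀' hgne₁
    rw [hd₁] at this; exact_mod_cast this
  obtain ⟨n₁, hn₁⟩ := exists_ordZero_eq_natCast (dirForm_ne_zero (W.j τ) (W.b τ) hd₁)
  have hrig₁ := stall_rigid (p ^ e) (W.j τ) (W.b τ) (W.onExc τ) (ifp W τ)
    (fun J hJ => (level_bounds W τ J hJ).2) (sing_ifp hp hs W τ) (by rw [← ifp_succ]; exact hst.symm.le) hJ₀' hμ' hd₁
  obtain ⟨-, h2₁, h3₁, -, -⟩ := hrig₁
  rw [hn₁, ENat.toNat_coe] at h2₁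
  have hgen₂ : (ifp W (τ + 1)).gen J₀ = PointBlowup.translate (W.b τ)
      (chartTransform (p ^ e - J₀.degree) (W.j τ) ((ifp W τ).gen J₀)) := by
    rw [ifp_succ]; rfl
  set E₁ : ℕ := D₁ - (p ^ e - J₀.degree) with hE₁
  have hd₂ : ordZero ((ifp W (τ + 1)).gen J₀) = ((E₁ + n₁ : ℕ) : ℕ∞) := by rw [ifp_succ]; exact h2₁
  have hJ₀'' : J₀ ∈ (ifp W (τ + 1)).idx := by rw [idx_ifp] at hJ₀' ⊢; exact hJ₀'
  have hμ'' : (ifp W (τ + 1)).muP (p ^ e) =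
      levelRatio (ordZero ((ifp W (τ + 1)).gen J₀)) (p ^ e - J₀.degree) := by
    rw [ifp_succ]; exact h3₁
  -- the cone at `τ + 1` contains `u_{j'}^{E₁} · in_{n₁}(dirForm at τ)`, whatever the cleanness at `τ`
  have hcone₂ : ∃ B' : MvPolynomial (Fin 3) K, homogeneousComponent (E₁ + n₁) ((ifp W (τ + 1)).gen J₀) =
      X (W.j τ) ^ E₁ * (homogeneousComponent n₁ (dirForm D₁ (W.j τ) (W.b τ) ((ifp W τ).gen J₀)) +
        X (W.j τ) * B') := by
    by_cases hcl : CleanMove D₁ (W.j τ) (W.b τ) ((ifp W τ).gen J₀)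
    · refine ⟨0, ?_⟩
      rw [mul_zero, add_zero, hgen₂]
      exact initialForm_move_of_clean (W.b τ) (W.onExc τ) ha₁ hd₁ hn₁ hcl
    · have hstallval₁ : ordZero (PointBlowup.translate (W.b τ)
          (chartTransform (p ^ e - J₀.degree) (W.j τ) ((ifp W τ).gen J₀))) = ((E₁ + n₁ : ℕ) : ℕ∞) := by
        rw [← hgen₂]; exact hd₂
      obtain ⟨m', -, -, -, hc'⟩ := resonance (W.b τ) (W.onExc τ) ha₁ hd₁ hn₁ hstallval₁ hcl
      exact ⟨homogeneousComponent m' (tailForm D₁ (W.j τ) (W.b τ) ((ifp W τ).gen J₀)), by rw [hgen₂]; exact hc'⟩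
  obtain ⟨B', hcone₂⟩ := hcone₂
  -- the direction form at `τ` is the cone at `τ` with `u_{j'}` deleted: homogeneous of degree `D₁ - f = n₁`
  have hdir : dirForm D₁ (W.j τ) (W.b τ) ((ifp W τ).gen J₀) =
      chartTransform D₁ (W.j τ) (homogeneousComponent D₁ ((ifp W τ).gen J₀)) := by
    unfold dirForm; rw [translate_eq_self hb]
  have hΦdeg : ∀ d ∈ (homogeneousComponent D₁ ((ifp W τ).gen J₀)).support, D₁ ≤ d.degree :=
    fun d hd => (degree_eq_of_mem_support_homogeneousComponent hd).ge
  have hn₁le : n₁ ≤ D₁ - m₁ (W.j τ) := by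
    have h := ordZero_dirForm_origin_le hb (W.j τ) hm₁mem
    rw [hn₁] at h; exact_mod_cast h
  have hn₁ge : D₁ - m₁ (W.j τ) ≤ n₁ := by
    have h : (((D₁ - m₁ (W.j τ) : ℕ) : ℕ∞)) ≤ ordZero (dirForm D₁ (W.j τ) (W.b τ) ((ifp W τ).gen J₀)) := by
      rw [natCast_le_ordZero_iff_forall_coeff]
      intro d hd
      by_contra hne
      rw [hdir] at hne
      obtain ⟨m₀, hm₀, hm₀d⟩ := exists_of_mem_support_chartTransform (MvPolynomial.mem_support_iff.mpr hne)
      have hm₀deg : m₀.degree = D₁ := degree_eq_of_mem_support_homogeneousComponent hm₀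
      have hm₀f : m₀ (W.j τ) = m₁ (W.j τ) := exponent_eq_of_originLawAt W τ hO₁ hb hJ₀' hμ' hd₁ hm₀ hm₁mem
      have hddeg : d.degree = D₁ - m₁ (W.j τ) := by
        rw [← hm₀d, degree_chartExponent, hm₀deg, Nat.sub_self, zero_add, hm₀f]
      omega
    rw [hn₁] at h; exact_mod_cast h
  have hn₁eq : n₁ = D₁ - m₁ (W.j τ) := le_antisymm hn₁le hn₁ge
  -- transport of a monomial of the cone at `τ` to the cone at `τ + 1`
  have transport : ∀ {μ : Fin 3 →₀ ℕ}, μ ∈ (homogeneousComponent D₁ ((ifp W τ).gen J₀)).support →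
      μ (W.j τ) = m₁ (W.j τ) →
      chartExponent D₁ (W.j τ) μ + Finsupp.single (W.j τ) E₁ ∈
        (homogeneousComponent (E₁ + n₁) ((ifp W (τ + 1)).gen J₀)).support := by
    intro μ hμmem hμf
    have hμdeg : μ.degree = D₁ := degree_eq_of_mem_support_homogeneousComponent hμmem
    have hcj' : chartExponent D₁ (W.j τ) μ (W.j τ) = 0 := by
      rw [chartExponent_apply, if_pos rfl, hμdeg, Nat.sub_self]
    have hcdeg : (chartExponent D₁ (W.j τ) μ).degree = n₁ := by
      rw [degree_chartExponent, hμdeg, Nat.sub_self, zero_add, hμf, hn₁eq]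
    rw [MvPolynomial.mem_support_iff, hcone₂, coeff_two_layer_low _ _ _ _ hcj', coeff_homogeneousComponent,
      if_pos hcdeg, hdir, coeff_chartExponent_chartTransform D₁ (W.j τ) hΦdeg hμmem]
    exact MvPolynomial.mem_support_iff.mp hμmem
  have hoff : ∀ (μ : Fin 3 →₀ ℕ) (i : Fin 3), i ≠ W.j τ →
      (chartExponent D₁ (W.j τ) μ + Finsupp.single (W.j τ) E₁) i = μ i := by
    intro μ i hi
    rw [Finsupp.add_apply, chartExponent_apply, if_neg hi, Finsupp.single_apply, if_neg (Ne.symm hi), add_zero]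
  have hon : ∀ μ : Fin 3 →₀ ℕ, μ.degree = D₁ →
      (chartExponent D₁ (W.j τ) μ + Finsupp.single (W.j τ) E₁) (W.j τ) = E₁ := by
    intro μ hμdeg
    rw [Finsupp.add_apply, chartExponent_apply, if_pos rfl, hμdeg, Nat.sub_self, zero_add, Finsupp.single_eq_same]
  refine ⟨J₀, E₁ + n₁, _, _, hJ₀'', hμ'', hd₂, transport hm₁mem rfl, transport hm₂mem hf.symm, ?_, ?_⟩
  · rw [hon m₁ (degree_eq_of_mem_support_homogeneousComponent hm₁mem),
      hon m₂ (degree_eq_of_mem_support_homogeneousComponent hm₂mem)]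
  · rw [hoff m₁ j hjj', hoff m₂ j hjj']; exact hm₁₂j

/-- **THE TURN-LOCK CHAIN.**  On a stalled stretch: after an INTERFERENCE at `t` and an untranslated CHART CHANGE at
`t + 1` (to `j' ≠ j_t`), every move of a run of consecutive untranslated moves `t + 1, …, t + 1 + k` is in chart `j'` —
after an interference the untranslated part of the walk can turn AT MOST ONCE before the next translation. [new] -/
theorem turn_lock_chain {p e : ℕ} (hp : p.Prime) [CharP K p] {s₀ : State (Fin 3) K} (hs : IsRoot (p ^ e) s₀)
    (W : ForcedWalk (p ^ e) s₀) (t : ℕ)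
    (hst : (ifp W (t + 1)).muTilde (p ^ e) = (ifp W t).muTilde (p ^ e)) (hunc : ¬ CleanAt W t)
    (hj₁ : W.j (t + 1) ≠ W.j t) (k : ℕ)
    (hstalls : ∀ i, i ≤ k → (ifp W (t + 1 + i + 1)).muTilde (p ^ e) = (ifp W (t + 1 + i)).muTilde (p ^ e))
    (hbs : ∀ i, i ≤ k → ∀ l, W.b (t + 1 + i) l = 0) : ∀ i, i ≤ k → W.j (t + 1 + i) = W.j (t + 1) := by
  have inv : ∀ i, i ≤ k → TwoMarks W (t + 1 + i) (W.j t) (W.j (t + 1)) ∧ W.j (t + 1 + i) = W.j (t + 1) := by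
    intro i
    induction i with
    | zero =>
      intro _
      exact ⟨twoMarks_of_interference_turn hp hs W t hst (hstalls 0 (Nat.zero_le _)) hunc (hbs 0 (Nat.zero_le _)), rfl⟩
    | succ i ih =>
      intro hi
      obtain ⟨hM, hji⟩ := ih (Nat.le_of_succ_le hi)
      have hM' : TwoMarks W (t + 1 + i + 1) (W.j t) (W.j (t + 1)) := by
        have hMi : TwoMarks W (t + 1 + i) (W.j t) (W.j (t + 1 + i)) := by rw [hji]; exact hM
        have := twoMarks_succ hp hs W (t + 1 + i) hMi (hstalls i (Nat.le_of_succ_le hi)) (hbs i (Nat.le_of_succ_le hi))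
        rw [hji] at this; exact this
      exact ⟨hM', chart_eq_of_twoMarks hp hs W (t + 1 + i + 1) hM' hj₁ (hstalls (i + 1) hi) (hbs (i + 1) hi)⟩
  exact fun i hi => (inv i hi).2

/-- **THE TURN-LOCK LAW** (the chain at `k = 1`).  On three consecutive STALLED moves `t, t+1, t+2` of a root walk: if
the move at `t` is an INTERFERENCE (unclean for some `μ_P`-minimiser), the move at `t + 1` is an UNTRANSLATED CHART
CHANGE and the move at `t + 2` is untranslated, then the move at `t + 2` REPEATS THE CHART of the move at `t + 1`:
AFTER AN INTERFERENCE THE WALK CANNOT MAKE TWO CONSECUTIVE UNTRANSLATED CHART CHANGES. [new] -/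
theorem turn_lock_law {p e : ℕ} (hp : p.Prime) [CharP K p] {s₀ : State (Fin 3) K} (hs : IsRoot (p ^ e) s₀)
    (W : ForcedWalk (p ^ e) s₀) (t : ℕ)
    (hst : (ifp W (t + 1)).muTilde (p ^ e) = (ifp W t).muTilde (p ^ e))
    (hst' : (ifp W (t + 1 + 1)).muTilde (p ^ e) = (ifp W (t + 1)).muTilde (p ^ e))
    (hst'' : (ifp W (t + 1 + 1 + 1)).muTilde (p ^ e) = (ifp W (t + 1 + 1)).muTilde (p ^ e))
    (hunc : ¬ CleanAt W t)
    (hb₁ : ∀ i, W.b (t + 1) i = 0) (hj₁ : W.j (t + 1) ≠ W.j t)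
    (hb₂ : ∀ i, W.b (t + 1 + 1) i = 0) : W.j (t + 1 + 1) = W.j (t + 1) := by
  have hstalls : ∀ i, i ≤ 1 → (ifp W (t + 1 + i + 1)).muTilde (p ^ e) = (ifp W (t + 1 + i)).muTilde (p ^ e) := by
    intro i hi
    interval_cases i
    · exact hst'
    · exact hst''
  have hbs : ∀ i, i ≤ 1 → ∀ l, W.b (t + 1 + i) l = 0 := by
    intro i hi
    interval_cases i
    · exact hb₁
    · exact hb₂
  exact turn_lock_chain hp hs W t hst hunc hj₁ 1 hstalls hbs 1 le_rfl

/-- **A DOUBLE UNTRANSLATED TURN RIGHT AFTER AN INTERFERENCE** at time `t` (a kernel predicate on three letters of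
the walk and one cleanness bit): the move at `t` is unclean for some `μ_P`-minimiser, the move at `t + 1` is an
untranslated chart change, and the move at `t + 2` is an untranslated chart change again. -/
def DoubleTurnAt (W : ForcedWalk q s₀) (t : ℕ) : Prop :=
  ¬ CleanAt W t ∧ (∀ i, W.b (t + 1) i = 0) ∧ W.j (t + 1) ≠ W.j t ∧ (∀ i, W.b (t + 1 + 1) i = 0) ∧
    W.j (t + 1 + 1) ≠ W.j (t + 1)

/-- No double untranslated turn after an interference on a `μ̃`-stalled stretch (hypothesis-free along root walks:
`turn_lock_law`). [new] -/
theorem not_doubleTurnAt_of_stall {p e : ℕ} (hp : p.Prime) [CharP K p] {s₀ : State (Fin 3) K}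
    (hs : IsRoot (p ^ e) s₀) (W : ForcedWalk (p ^ e) s₀) (N : ℕ)
    (hstall : ∀ t, N ≤ t → (ifp W (t + 1)).muTilde (p ^ e) = (ifp W t).muTilde (p ^ e))
    (t : ℕ) (ht : N ≤ t) : ¬ DoubleTurnAt W t := by
  rintro ⟨hunc, hb₁, hj₁, hb₂, hj₂⟩
  exact hj₂ (turn_lock_law hp hs W t (hstall t ht) (hstall (t + 1) (by omega)) (hstall (t + 1 + 1) (by omega))
    hunc hb₁ hj₁ hb₂)

/-- **THE TWO MOVES AFTER AN INTERFERENCE** (echo law + turn-lock law, tail form): on a `μ̃`-stalled stretch, after an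
interference at `t` EITHER the move at `t + 1` translates, OR it is an untranslated chart change to `j'` and then the
move at `t + 2` translates or repeats the chart `j'` untranslated. [new] -/
theorem two_moves_after_interference {p e : ℕ} (hp : p.Prime) [CharP K p] {s₀ : State (Fin 3) K}
    (hs : IsRoot (p ^ e) s₀) (W : ForcedWalk (p ^ e) s₀) (N : ℕ)
    (hstall : ∀ t, N ≤ t → (ifp W (t + 1)).muTilde (p ^ e) = (ifp W t).muTilde (p ^ e))
    (t : ℕ) (ht : N ≤ t) (hunc : ¬ CleanAt W t) :
    (∃ i, W.b (t + 1) i ≠ 0) ∨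
      (W.j (t + 1) ≠ W.j t ∧ ((∃ i, W.b (t + 1 + 1) i ≠ 0) ∨ W.j (t + 1 + 1) = W.j (t + 1))) := by
  by_cases hb₁ : ∃ i, W.b (t + 1) i ≠ 0
  · exact Or.inl hb₁
  rw [not_exists] at hb₁
  have hb₁' : ∀ i, W.b (t + 1) i = 0 := fun i => by have := hb₁ i; rwa [not_not] at this
  have hj₁ : W.j (t + 1) ≠ W.j t := by
    intro hj
    exact hunc (echo_law hp hs W t (hstall t ht) (hstall (t + 1) (by omega)) hj hb₁')
  refine Or.inr ⟨hj₁, ?_⟩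
  by_cases hb₂ : ∃ i, W.b (t + 1 + 1) i ≠ 0
  · exact Or.inl hb₂
  rw [not_exists] at hb₂
  have hb₂' : ∀ i, W.b (t + 1 + 1) i = 0 := fun i => by have := hb₂ i; rwa [not_not] at this
  exact Or.inr (turn_lock_law hp hs W t (hstall t ht) (hstall (t + 1) (by omega)) (hstall (t + 1 + 1) (by omega))
    hunc hb₁' hj₁ hb₂')

/-- **A SECOND TURN IN THE UNTRANSLATED RUN AFTER AN INTERFERENCE** at time `t` (kernel predicate on the letters of
the walk and one cleanness bit): the move at `t` is unclean for some `μ_P`-minimiser, the move at `t + 1` is an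
untranslated chart change (to `j'`), and some later move `t + 1 + k` of the UNTRANSLATED RUN `t + 1, …, t + 1 + k` is in
a chart `≠ j'`.  `DoubleTurnAt` is its instance `k = 1`. -/
def SecondTurnAt (W : ForcedWalk q s₀) (t : ℕ) : Prop :=
  ¬ CleanAt W t ∧ (∀ i, W.b (t + 1) i = 0) ∧ W.j (t + 1) ≠ W.j t ∧
    ∃ k, (∀ i, i ≤ k → ∀ l, W.b (t + 1 + i) l = 0) ∧ W.j (t + 1 + k) ≠ W.j (t + 1)

/-- `secondTurnAt_of_doubleTurnAt`: Auxiliary step of this node's calculus, VERBATIM from the lens file (see the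
module docstring); the statement is its type. [folklore] -/
theorem secondTurnAt_of_doubleTurnAt (W : ForcedWalk q s₀) (t : ℕ) (h : DoubleTurnAt W t) : SecondTurnAt W t := by
  obtain ⟨hunc, hb₁, hj₁, hb₂, hj₂⟩ := h
  refine ⟨hunc, hb₁, hj₁, 1, ?_, hj₂⟩
  intro i hi
  interval_cases i
  · exact hb₁
  · exact hb₂

/-- No second turn in the untranslated run after an interference on a `μ̃`-stalled stretch (`turn_lock_chain`). [new] -/
theorem not_secondTurnAt_of_stall {p e : ℕ} (hp : p.Prime) [CharP K p] {s₀ : State (Fin 3) K}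
    (hs : IsRoot (p ^ e) s₀) (W : ForcedWalk (p ^ e) s₀) (N : ℕ)
    (hstall : ∀ t, N ≤ t → (ifp W (t + 1)).muTilde (p ^ e) = (ifp W t).muTilde (p ^ e))
    (t : ℕ) (ht : N ≤ t) : ¬ SecondTurnAt W t := by
  rintro ⟨hunc, -, hj₁, k, hbs, hjk⟩
  exact hjk (turn_lock_chain hp hs W t (hstall t ht) hunc hj₁ k (fun i _ => hstall (t + 1 + i) (by omega)) hbs k le_rfl)

end WalkLock

end Summit.ResolutionOfSingularities.ResolutionOfSingularities.Theorems.StallVertex
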